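import Summits.ResolutionOfSingularities.ResolutionOfSingularities.Theorems.WeightedInvariantIota3SteepPinningW
import HarnessLib

/-!
# (STEEP) ⟸ (STEEP-W), local form: at a regular local threefold with `𝔪 = (T, z, W)` the steep one-flag bound for `g = c W^ν + T H` needs checking
# only along `W`-LED parameters (door `HypersurfaceCentreConstruction`, stmt-ResolutionOfSingularities-19897)

Helper for `stub_keyRungGrHomLE_three` (def-free, `--supports 19897`): the position-level form of the reduction (STEEP) ⟸ (STEEP-W) behind this
hand's gap list (…KeyRungThreeOfDropCurveSteep), from the pinning theorem `Iota3.steep_pinning` (…Iota3SteepPinningW).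

* **`Iota3.exists_eq_combination_of_mem_span_triple`** — an element of `(x, y, z)` is a combination `a x + b y + c z`.
* **`Iota3.steepBound_of_wLed`** — `L` regular local of dimension three, `𝔪 = (T, z, W)`, `g = c W^ν + T H` (`c` a unit, `ν ≥ 1`), `Φ` any
  predicate on steep weights: if `Φ a b` holds for every steep reach (`0 < b < a`, `g ∈ ratContactFiltration g₁ a b (aν)`) along a `W`-LED
  `g₁ = α T + γ z + δ W` (`γ ∈ 𝔪`, `δ` a unit), then it holds for every steep reach along ANY `g₁ ∈ 𝔪`.

[OURS · L1 W4.3 · kernel lemma; AI work, weaker than expert review; nothing here is a statement of the manuscript under review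
(Hironaka 2017, [claim: Hironaka2017, status: under-review]).]

## References

* H. Hironaka, *Characteristic polyhedra of singularities*, J. Math. Kyoto Univ. 7 (1967), §3. [Hironaka1967]
-/

noncomputable section

set_option linter.dupNamespace false -- mandated namespace of this single-conjunct summit

open IsLocalRing Literature.AlgebraicGeometry.Resolution
open Summit.ResolutionOfSingularities.ResolutionOfSingularities.Theorems
open Summit.ResolutionOfSingularities.ResolutionOfSingularities.Cruxes.HypersurfaceCentreConstruction.LocalEngine.Iota3.RatContact

namespace Summit.ResolutionOfSingularities.ResolutionOfSingularities.Cruxes.HypersurfaceCentreConstruction.LocalEngine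

namespace Iota3

/-- Membership in a span of three elements, as a linear combination. [folklore] -/
theorem exists_eq_combination_of_mem_span_triple {R : Type} [CommRing R] {x y z g : R} (h : g ∈ Ideal.span ({x, y, z} : Set R)) :
    ∃ a b c : R, g = a * x + b * y + c * z := by
  rw [Ideal.mem_span_insert] at h
  obtain ⟨a, g', hg', rfl⟩ := h
  rw [Ideal.mem_span_pair] at hg'
  obtain ⟨b, c, rfl⟩ := hg'
  exact ⟨a, b, c, by ring⟩

/-- **(STEEP) ⟸ (STEEP-W), position level**: `L` regular local of dimension three, `𝔪 = (T, z, W)`, `g = c W^ν + T H` with `c` a unit, `ν ≥ 1`.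
If a predicate `Φ a b` of the steep weights holds for every steep reach of `g` along a `W`-LED parameter `g₁ = α T + γ z + δ W` (`γ ∈ 𝔪`, `δ` a unit),
then it holds for every steep reach of `g` along any `g₁ ∈ 𝔪` (`Iota3.steep_pinning`). [OURS · L1 W4.3] [cite: Hironaka1967, §3] -/
theorem steepBound_of_wLed {L : Type} [CommRing L] [IsRegularLocalRing L] (hdim : ringKrullDim L = (3 : ℕ)) {T z W c H : L}
    (hspan : Ideal.span {T, z, W} = maximalIdeal L) (hc : IsUnit c) {ν : ℕ} (hν : 1 ≤ ν) (Φ : ℕ → ℕ → Prop)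
    (hW : ∀ (g₁ α γ δ : L), g₁ = α * T + γ * z + δ * W → γ ∈ maximalIdeal L → IsUnit δ → ∀ a b : ℕ, 0 < b → b < a →
      c * W ^ ν + T * H ∈ ratContactFiltration g₁ a b (a * ν) → Φ a b) :
    ∀ g₁ ∈ maximalIdeal L, ∀ a b : ℕ, 0 < b → b < a → c * W ^ ν + T * H ∈ ratContactFiltration g₁ a b (a * ν) → Φ a b := by
  intro g₁ hg₁ a b hb hab hreach
  rw [← hspan] at hg₁
  obtain ⟨α, γ, δ, hg₁eq⟩ := exists_eq_combination_of_mem_span_triple hg₁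
  have hreach' : c * W ^ ν + T * H ∈ ratContactFiltration (α * T + γ * z + δ * W) a b (a * ν) := hg₁eq ▸ hreach
  obtain ⟨hγ, hδ⟩ := steep_pinning hdim hspan hc hν hb hab hreach'
  exact hW g₁ α γ δ hg₁eq hγ hδ a b hb hab hreach

end Iota3

end Summit.ResolutionOfSingularities.ResolutionOfSingularities.Cruxes.HypersurfaceCentreConstruction.LocalEngine

end
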